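import Summits.RiemannHypothesis.RiemannHypothesis.Theorems.GroundBartaEvenWinsBeyondArchDeflationPrimeY
import Summits.RiemannHypothesis.RiemannHypothesis.Theorems.WeilGroundStateGroundStateSimpleEvenKillingIntegral
import Literature.Analysis.SpecialFunctions.LogPiBounds
import Literature.Analysis.SpecialFunctions.EulerMascheroniSharpBounds
import HarnessLib

/-!
# RiemannHypothesis / GroundBarta — rung 4 (`EvenWinsBeyondArch`, stmt-RiemannHypothesis-18807 / 18085):
# the deflated Temple L-side, A-layer V — two-sided enclosure of the killing constant `M_b` on the `{2,3,4}`-window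

Helper file (`--supports`), RH-free.  Prover A, speedrun unit `sr-gb-rung-a` (gen 2).

`M_b = √2·log 2 + (2/√3)·log 3 + log 2 + 2(π/4 + (log 2)/2) + log 4 + log π + γ` for `log 2 < b ≤ (log 5)/2`
(`weilMarkovConstant_threePrime`, `kill_integral_weilKillingDensity_eq`), enclosed in `MI` arithmetic from `MI.logNat`,
`MI.pi`, the 20-digit `log π` and the 16-digit `γ` brackets of the tree: `markovBoundsY`/`markovCheckY`/
`dt_weilMarkovConstant_mem`.  Width ≈ 8·10⁻¹⁵ (the `γ` bracket), adequate for the cells of the parity ladder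
(`ρ₁ ≈ 4·10⁻¹¹`).

References: E. Bombieri, Rend. Mat. Acc. Lincei (9) 11 (2000) 183–233, Thm 2 [Bombieri2000Weil].
-/

set_option linter.dupNamespace false

noncomputable section

open MeasureTheory Set
open scoped BigOperators

namespace Summit.RiemannHypothesis.RiemannHypothesis.Theorems.EvenWinsBeyondArch

open Literature.NumberTheory.LFunctions Literature.Analysis.ValidatedNumerics.ExpPoly
open Literature.Analysis.ValidatedNumerics.PolyMP Literature.Analysis.ValidatedNumerics.NumericsMP
open Summit.RiemannHypothesis.RiemannHypothesis.Theorems.GroundStateSimpleEven (kill_integral_weilKillingDensity_eq)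

/-- The kernel enclosure of `π` (junk if it fails, excluded by the check). [folklore] -/
def piMI (S K : ℕ) : MI := (MI.pi S K).getD ⟨0, 0⟩

/-- [folklore] -/
theorem mem_piMI (S : ℕ) {K : ℕ} (h : (MI.pi S K).isSome = true) : MI.mem S Real.pi (piMI S K) := by
  obtain ⟨Y, hY⟩ := Option.isSome_iff_exists.1 h
  have : piMI S K = Y := by simp [piMI, hY]
  rw [this]; exact MI.mem_pi S hY

/-- The enclosure of `M_b` on the `{2,3,4}`-window: `√2 log 2 + (2/√3) log 3 + 2 log 2 + π/2 + log 4 + log π + γ`. [folklore] -/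
def markovBoundsY (S K : ℕ) (s2lo s2hi i3lo i3hi : ℚ) : ℤ × ℤ :=
  let l2 : MI := logNatMI S K 2
  let l3 : MI := logNatMI S K 3
  let l4 : MI := logNatMI S K 4
  let t1 : MI := MI.mul S (ratBracketMI S s2lo s2hi) l2
  let t2 : MI := MI.mul S (MI.mul S (ofRat S 2) (ratBracketMI S i3lo i3hi)) l3
  let t3 : MI := MI.mul S (ofRat S 2) l2
  let t4 : MI := MI.mul S (piMI S K) (ofRat S (1 / 2))
  let t5 : MI := ratBracketMI S (1.14472988584940017414 : ℚ) (1.14472988584940017415 : ℚ)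
  let t6 : MI := ratBracketMI S (0.5772156649015328 : ℚ) (0.5772156649015405 : ℚ)
  let R : MI := MI.add (MI.add (MI.add (MI.add (MI.add (MI.add t1 t2) t3) t4) l4) t5) t6
  (R.lo, R.hi)

/-- The check: `log`/`π` enclosures succeed; `√2 ∈ [s2lo, s2hi]`, `1/√3 ∈ [i3lo, i3hi]` brackets valid. [folklore] -/
def markovCheckY (S K : ℕ) (s2lo s2hi i3lo i3hi : ℚ) : Bool :=
  (MI.logNat S K 2).isSome && (MI.logNat S K 3).isSome && (MI.logNat S K 4).isSome && (MI.pi S K).isSome &&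
    decide (0 ≤ s2lo) && decide (s2lo ^ 2 ≤ 2) && decide (0 ≤ s2hi) && decide (2 ≤ s2hi ^ 2) &&
    decide (0 ≤ i3lo) && decide (i3lo ^ 2 * 3 ≤ 1) && decide (0 ≤ i3hi) && decide (1 ≤ i3hi ^ 2 * 3)

/-- **Two-sided enclosure of the killing constant on the `{2,3,4}`-window.** [cite: Bombieri2000Weil, Thm 2] -/
theorem dt_weilMarkovConstant_mem {b : ℝ} (hb2 : Real.log 2 < b) (hb5 : b ≤ Real.log 5 / 2) {S K : ℕ} (hS : 0 < S)
    {s2lo s2hi i3lo i3hi : ℚ} (hchk : markovCheckY S K s2lo s2hi i3lo i3hi = true) :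
    ((markovBoundsY S K s2lo s2hi i3lo i3hi).1 : ℝ) / S ≤ weilMarkovConstant b ∧
      weilMarkovConstant b ≤ ((markovBoundsY S K s2lo s2hi i3lo i3hi).2 : ℝ) / S := by
  unfold markovCheckY at hchk
  simp only [Bool.and_eq_true, decide_eq_true_eq] at hchk
  obtain ⟨⟨⟨⟨⟨⟨⟨⟨⟨⟨⟨hl2, hl3⟩, hl4⟩, hpi⟩, a0⟩, a1⟩, a2⟩, a3⟩, c0⟩, c1⟩, c2⟩, c3⟩ := hchk
  rw [weilMarkovConstant_threePrime hb2 hb5, kill_integral_weilKillingDensity_eq]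
  have m2 := mem_logNatMI hS hl2
  have m3 := mem_logNatMI hS hl3
  have m4 := mem_logNatMI hS hl4
  have mp := mem_piMI S hpi
  -- √2 bracket
  have hs2 : (s2lo : ℝ) ≤ Real.sqrt 2 ∧ Real.sqrt 2 ≤ (s2hi : ℝ) := by
    constructor
    · calc (s2lo : ℝ) = Real.sqrt ((s2lo : ℝ) ^ 2) := (Real.sqrt_sq (by exact_mod_cast a0)).symm
        _ ≤ Real.sqrt 2 := Real.sqrt_le_sqrt (by exact_mod_cast a1)
    · calc Real.sqrt 2 ≤ Real.sqrt ((s2hi : ℝ) ^ 2) := Real.sqrt_le_sqrt (by exact_mod_cast a3)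
        _ = s2hi := Real.sqrt_sq (by exact_mod_cast a2)
  obtain ⟨i3a, i3b⟩ := inv_sqrt_mem_of_bracket (n := 3) (by norm_num) c0 c1 c2 c3
  have t1 := MI.mem_mul hS (mem_ratBracketMI S hs2.1 hs2.2) m2
  have t2 := MI.mem_mul hS (MI.mem_mul hS (mem_ofRat S 2) (mem_ratBracketMI S i3a i3b)) m3
  have t3 := MI.mem_mul hS (mem_ofRat S 2) m2
  have t4 := MI.mem_mul hS mp (mem_ofRat S (1 / 2))
  have t5 := mem_ratBracketMI S (le_of_lt Literature.Analysis.SpecialFunctions.Real.log_pi_gt_d20)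
    (le_of_lt Literature.Analysis.SpecialFunctions.Real.log_pi_lt_d20)
  have t6 := mem_ratBracketMI S (le_of_lt Literature.Analysis.SpecialFunctions.Real.eulerMascheroniConstant_gt_d16)
    (le_of_lt Literature.Analysis.SpecialFunctions.Real.eulerMascheroniConstant_lt_d16)
  have hR := MI.mem_add (MI.mem_add (MI.mem_add (MI.mem_add (MI.mem_add (MI.mem_add t1 t2) t3) t4) m4) t5) t6
  obtain ⟨hlo, hhi⟩ := hR
  have hSr : (0 : ℝ) < S := by exact_mod_cast hS
  -- identify: log 2/√2 = √2 log 2 / 2, log 3/√3 = (1/√3) log 3, log(4π) = log 4 + log π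
  have hsqrt2 : Real.log 2 / Real.sqrt 2 = Real.sqrt 2 * Real.log 2 / 2 := by
    have h2 : Real.sqrt 2 * Real.sqrt 2 = 2 := Real.mul_self_sqrt (by norm_num)
    have hpos : 0 < Real.sqrt 2 := Real.sqrt_pos.2 (by norm_num)
    field_simp
    nlinarith [h2]
  have hsqrt3 : Real.log 3 / Real.sqrt 3 = 1 / Real.sqrt 3 * Real.log 3 := by ring
  have hlog4pi : Real.log (4 * Real.pi) = Real.log (4 : ℕ) + Real.log Real.pi := by
    rw [Real.log_mul (by norm_num) Real.pi_pos.ne']; push_cast; ring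
  have hval : 2 * (Real.log 2 / Real.sqrt 2 + Real.log 3 / Real.sqrt 3 + Real.log 2 / 2) + 2 * (Real.pi / 4 + Real.log 2 / 2) +
        (Real.log (4 * Real.pi) + Real.eulerMascheroniConstant) =
      Real.sqrt 2 * Real.log (2 : ℕ) + 2 * (1 / Real.sqrt (3 : ℕ)) * Real.log (3 : ℕ) + 2 * Real.log (2 : ℕ) + Real.pi * (1 / 2) +
        Real.log (4 : ℕ) + Real.log Real.pi + Real.eulerMascheroniConstant := by
    rw [hsqrt2, hsqrt3, hlog4pi]; push_cast; ring
  rw [hval]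
  unfold markovBoundsY
  simp only []
  constructor
  · rw [div_le_iff₀ hSr]; push_cast at hlo ⊢; exact hlo
  · rw [le_div_iff₀ hSr]; push_cast at hhi ⊢; exact hhi

end Summit.RiemannHypothesis.RiemannHypothesis.Theorems.EvenWinsBeyondArch

end
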